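import Summits.Ventures.QEC.Census.BZAutPerm
import HarnessLib

/-!
# `bz_aut` with explicit-permutation automorphisms — the label COVER over words and the assembled lower bounds
# (qec row 12, automorphism-orbit reduction; companion of `Census/BZAutPerm.lean`)

`Census/BZAutPerm.lean` turns the generic `aut` entries of a kernel-A `bz_aut` certificate (CERT-FORMAT §5.5:
permutation table `perm`, row maps `rowsX` / `rowsZ`), organised as a few checked GENERATORS and the automorphisms as
WORDS in them, into the transport hypothesis `hφ` of the engine soundness theorems.  This file supplies the other
hypothesis and the closers, for ANY CSS certificate (no typed code family):

* `rhoColsPerm n Ld L perm` — the `k` columns of the label action `ρ_σ` as label words (column `j` = label of the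
  transported logical `permWord perm L[j] n`); `ofBits_xorSel_rhoColsPerm`: the tabulated probe IS `ρ_σ *ᵥ λ`;
* `coverAutPermOK n Ld L gens words blocks` — C5 with automorphisms over words: every non-zero label `λ < 2^k` is in
  the cover mask directly or after some listed word (`decide +kernel`; cost `≈ 2^k ·` mean probes); its WITNESSED form
  `coverAutPermWitOK … wit …` (one probe per label, `wit[λ]` = the word to use) and its RANGE-SHARDED form
  `coverAutPermRangeOK … lo hi` (labels `lo ≤ λ < hi`, one kernel evaluation per chunk) with the glue
  `coverAutPerm_sound_of_chunks` along cut points `[0, c₁, …, 2^k]`; soundness of all three;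
* `bzAut_perm_hcover` / `_wit` / `_chunks` — the `hcover` hypothesis of type-10's `bzAut_lower_sound` /
  `bzAut_lower_sound_sem` / qec-search-9's `bzAut_lower_sound_mitm` for `α := {w // w ∈ words}`,
  `ρ_w = LX · (LZ ∘ (wordEquiv n gens w)⁻¹)ᵀ`;
* `bzAut_perm_lower` (BZ engine: structural + block verdicts + `autGensOK` + `autWordsOK` + `coverAutPermOK`, all
  `decide`, ⊢ `∀ w, Hsyn w = 0 → w ∉ rowspace Hstab → wmax < |w|`) and `bzAut_perm_lower_sem` (lane-agnostic, semantic
  block bounds) — the closers a generalized-bicycle / two-block-group-algebra / any-indexing BB `bz_aut` certificate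
  instantiates; the conclusion is the input of the existing `dZ_code` / `d_eq_of_witness` closers on `cert.code`.

USE (side `Z`; side `X` swaps the roles: `Hsyn := HZ`, `Hstab := HX`, `Ld := LZ`, `L := LX`, `rowsSyn := rowsZ`):

    theorem gens_ok  : autGensOK n cert.HX cert.HZ gensZ = true := by decide +kernel
    theorem words_ok : autWordsOK gensZ.length wordsZ = true := by decide +kernel
    theorem cover_ok : coverAutPermOK n bz.LX bz.LZ (autPerms gensZ) wordsZ bz.sideZ.blocks = true := by decide +kernel
    … bzAut_perm_lower hcomm hfound hcore hlen hblocks gens_ok words_ok cover_ok w hw hw'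

where for an abelian group `ℤ_{m₁} × ⋯ × ℤ_{m_r}` a good generator set is the translations by `2^j e_i` (`r · ⌈log₂ m_i⌉`
checked automorphisms, words = binary expansions, ≤ `Σ ⌈log₂ m_i⌉` letters).  Validated in the kernel on real kernel-A
certificates (session scratch): GB `[[78,6,11]]` over `ℤ₃₉` (6 generators, 38 words, 7 blocks: all three checks
`decide +kernel` in < 10 s).  HONEST FRAMING: no certificate is read here and no distance value is asserted; tier
KERNEL, axioms standard, no `native_decide`.  Sources: Brouwer–Zimmermann with automorphisms [Grassl 2006 §2.2];
automorphisms as qubit/check permutations and their action on logicals [Bravyi et al. 2024 SI §9.2]; Lean ingredients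
type-12 `OrbitBZCover` (`labelWord`, `xorSel` lemmas), type-10 `CertCheckBZAutSound` / `CertCheckBZAutSem`.
-/

namespace Summit.Ventures.QEC.Census

open Matrix Literature.InformationTheory.QuantumCodes

/-! ## C5 with explicit-permutation automorphisms: the label cover over words, tabulated -/

section Cover

/-- The `k` columns of the label action `ρ_σ` as label words, for a permutation TABLE `perm`: column `j` = label
(w.r.t. the dual rows `Ld`) of the transported logical `permWord perm L[j] n`. (definition) -/
def rhoColsPerm (n : ℕ) (Ld L : List ℕ) (perm : List ℕ) : List ℕ :=
  L.map fun lz => labelWord n Ld (permWord (permFun perm) lz n)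

/-- **C5 for method `bz_aut` with explicit-permutation automorphisms given as WORDS in generator tables**
(CERT-FORMAT §5.5 "cover"): every non-zero label word `λ < 2^k` (`k = |L|`) is covered by `coverMask blocks`
directly, or `ρ_w · λ` is for some listed word `w` — probed on the tabulated columns
(`xorSel (rhoColsPerm n Ld L (wordPerm n gens w)) λ`). (definition, `decide +kernel`) -/
def coverAutPermOK (n : ℕ) (Ld L : List ℕ) (gens : List (List ℕ)) (words : List (List ℕ))
    (blocks : List BZBlock) : Bool :=
  let cm := coverMask blocks
  let tabs := words.map fun w => rhoColsPerm n Ld L (wordPerm n gens w)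
  (List.range (2 ^ L.length)).all fun lam =>
    (lam == 0) || cm.testBit lam || tabs.any fun cols => cm.testBit (xorSel cols lam)

/-- **Witnessed form** (one probe per label): `wit[λ]` names the word to use for label `λ` (labels covered directly
need no valid witness). Same soundness as `coverAutPermOK`; kernel cost `O(2^k)` probes instead of `O(2^k · |words|)`.
(definition, `decide +kernel`) -/
def coverAutPermWitOK (n : ℕ) (Ld L : List ℕ) (gens : List (List ℕ)) (words : List (List ℕ)) (wit : List ℕ)
    (blocks : List BZBlock) : Bool :=
  let cm := coverMask blocks
  let tabs := words.map fun w => rhoColsPerm n Ld L (wordPerm n gens w)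
  (List.range (2 ^ L.length)).all fun lam =>
    (lam == 0) || cm.testBit lam ||
      (decide (wit.getD lam 0 < words.length) && cm.testBit (xorSel (tabs.getD (wit.getD lam 0) []) lam))

variable {n : ℕ}

/-- **The tabulated probe is `ρ_σ *ᵥ λ`** for a permutation table agreeing with `σ`:
`ofBits k (xorSel (rhoColsPerm n Ld L perm) w) = (Ld' * (L'.submatrix id σ⁻¹)ᵀ) *ᵥ ofBits k w`
(`Ld' i = ofBits n Ld[i]`, `L' j = ofBits n L[j]`). -/
theorem ofBits_xorSel_rhoColsPerm {Ld L : List ℕ} {Ld' L' : Matrix (Fin L.length) (Fin n) (ZMod 2)}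
    (hLd : ∀ i, Ld' i = ofBits n (Ld.getD i 0)) (hL : ∀ j, L' j = ofBits n (L.getD j 0))
    {perm : List ℕ} (σ : Fin n ≃ Fin n) (hσ : ∀ q : Fin n, permFun perm q = ((σ q : Fin n) : ℕ)) (w : ℕ) :
    ofBits L.length (xorSel (rhoColsPerm n Ld L perm) w) =
      (Ld' * (L'.submatrix id σ.symm)ᵀ) *ᵥ ofBits L.length w := by
  have htr : ∀ v : ℕ, ofBits n (permWord (permFun perm) v n) = ofBits n v ∘ σ.symm :=
    fun v => ofBits_permWord σ (permFun perm) hσ v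
  have hlen : (rhoColsPerm n Ld L perm).length = L.length := List.length_map ..
  have hget : ∀ j : ℕ, (rhoColsPerm n Ld L perm).getD j 0 =
      labelWord n Ld (permWord (permFun perm) (L.getD j 0) n) := by
    intro j
    have h0 : labelWord n Ld (permWord (permFun perm) 0 n) = 0 := by
      rw [permWord_zero, labelWord_zero]
    rw [rhoColsPerm, ← h0, List.getD_map, h0]
  rw [ofBits_xorSel_eq_sum_range, hlen]
  funext i
  -- both sides are `∑_{j < k} [bit j of w] · ⟨Ld_i, L_j ∘ σ⁻¹⟩`
  let F : ℕ → ZMod 2 := fun x =>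
    if w.testBit x then Ld' i ⬝ᵥ (ofBits n (L.getD x 0) ∘ σ.symm) else 0
  have hR : ((Ld' * (L'.submatrix id σ.symm)ᵀ) *ᵥ ofBits L.length w) i = ∑ x ∈ Finset.range L.length, F x := by
    rw [← Fin.sum_univ_eq_sum_range]
    change ∑ j, (Ld' * (L'.submatrix id σ.symm)ᵀ) i j * ofBits L.length w j = _
    refine Finset.sum_congr rfl fun j _ => ?_
    rw [CSSCode.labelAction_apply, hL j]
    change _ * (if w.testBit j then 1 else 0) = F j
    by_cases hb : w.testBit j = true
    · simp [F, hb]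
    · simp [F, hb]
  have hLHS : (∑ j ∈ Finset.range L.length,
      if w.testBit j then ofBits L.length ((rhoColsPerm n Ld L perm).getD j 0) else 0) i =
      ∑ x ∈ Finset.range L.length, F x := by
    rw [Finset.sum_apply]
    refine Finset.sum_congr rfl fun x _ => ?_
    by_cases hb : w.testBit x = true
    · simp only [hb, if_true, F]
      rw [hget, ofBits_labelWord_apply, ← hLd i, htr]
    · simp [hb, F]
  rw [hLHS, hR]

/-- **Soundness of `coverAutPermOK`.** Let `P` be any property of labels implied by a set bit of the cover mask
(type-10: `P λ := ∃ b, λ ∈ span W_b`). If the generator tables are valid and every word's letters name generators,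
then every non-zero label `λ` satisfies `P λ`, or `P (ρ_w *ᵥ λ)` for some LISTED word `w`
(`ρ_w = Ld' * (L'.submatrix id (wordEquiv n gens w)⁻¹)ᵀ`). -/
theorem coverAutPermOK_sound {Ld L : List ℕ} {gens words : List (List ℕ)} {blocks : List BZBlock}
    (h : coverAutPermOK n Ld L gens words blocks = true)
    (hgens : ∀ g ∈ gens, permListOK n g = true) (hwords : ∀ w ∈ words, ∀ g ∈ w, g < gens.length)
    {P : (Fin L.length → ZMod 2) → Prop}
    (hP : ∀ w : ℕ, (coverMask blocks).testBit w = true → P (ofBits L.length w))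
    {Ld' L' : Matrix (Fin L.length) (Fin n) (ZMod 2)}
    (hLd : ∀ i, Ld' i = ofBits n (Ld.getD i 0)) (hL : ∀ j, L' j = ofBits n (L.getD j 0))
    (lam : Fin L.length → ZMod 2) (hlam : lam ≠ 0) :
    P lam ∨ ∃ w ∈ words, P ((Ld' * (L'.submatrix id (wordEquiv n gens w).symm)ᵀ) *ᵥ lam) := by
  obtain ⟨v, hvlt, rfl⟩ : ∃ v, v < 2 ^ L.length ∧ ofBits L.length v = lam :=
    ⟨toBits lam, toBits_lt lam, ofBits_toBits lam⟩
  have hv0 : v ≠ 0 := by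
    rintro rfl
    exact hlam (ofBits_zero _)
  simp only [coverAutPermOK, List.all_eq_true, List.mem_range, Bool.or_eq_true, beq_iff_eq, List.any_eq_true,
    List.mem_map] at h
  rcases h v hvlt with (h0 | hbit) | ⟨cols, ⟨w, hw, rfl⟩, hbit⟩
  · exact absurd h0 hv0
  · exact Or.inl (hP v hbit)
  · refine Or.inr ⟨w, hw, ?_⟩
    rw [← ofBits_xorSel_rhoColsPerm hLd hL (wordEquiv n gens w) (wordEquiv_val hgens w (hwords w hw)) v]
    exact hP _ hbit

/-- **Soundness of the witnessed form** (same conclusion as `coverAutPermOK_sound`). -/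
theorem coverAutPermWitOK_sound {Ld L : List ℕ} {gens words : List (List ℕ)} {wit : List ℕ}
    {blocks : List BZBlock} (h : coverAutPermWitOK n Ld L gens words wit blocks = true)
    (hgens : ∀ g ∈ gens, permListOK n g = true) (hwords : ∀ w ∈ words, ∀ g ∈ w, g < gens.length)
    {P : (Fin L.length → ZMod 2) → Prop}
    (hP : ∀ w : ℕ, (coverMask blocks).testBit w = true → P (ofBits L.length w))
    {Ld' L' : Matrix (Fin L.length) (Fin n) (ZMod 2)}
    (hLd : ∀ i, Ld' i = ofBits n (Ld.getD i 0)) (hL : ∀ j, L' j = ofBits n (L.getD j 0))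
    (lam : Fin L.length → ZMod 2) (hlam : lam ≠ 0) :
    P lam ∨ ∃ w ∈ words, P ((Ld' * (L'.submatrix id (wordEquiv n gens w).symm)ᵀ) *ᵥ lam) := by
  obtain ⟨v, hvlt, rfl⟩ : ∃ v, v < 2 ^ L.length ∧ ofBits L.length v = lam :=
    ⟨toBits lam, toBits_lt lam, ofBits_toBits lam⟩
  have hv0 : v ≠ 0 := by
    rintro rfl
    exact hlam (ofBits_zero _)
  simp only [coverAutPermWitOK, List.all_eq_true, List.mem_range, Bool.or_eq_true, beq_iff_eq, Bool.and_eq_true,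
    decide_eq_true_eq] at h
  rcases h v hvlt with (h0 | hbit) | ⟨hidx, hbit⟩
  · exact absurd h0 hv0
  · exact Or.inl (hP v hbit)
  · set w := words[wit.getD v 0] with hwdef
    have hw : w ∈ words := List.getElem_mem hidx
    have htab : (words.map fun w => rhoColsPerm n Ld L (wordPerm n gens w)).getD (wit.getD v 0) [] =
        rhoColsPerm n Ld L (wordPerm n gens w) := by
      rw [List.getD_eq_getElem?_getD, List.getElem?_map, List.getElem?_eq_getElem hidx, Option.map_some,
        Option.getD_some]
    refine Or.inr ⟨w, hw, ?_⟩
    rw [← ofBits_xorSel_rhoColsPerm hLd hL (wordEquiv n gens w) (wordEquiv_val hgens w (hwords w hw)) v, ← htab]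
    exact hP _ hbit

/-! ### Range-sharded form (one `decide` per label chunk, glued by `coverAutPerm_sound_of_chunks`) -/

/-- **Range form**: the same probes for the labels `lo ≤ λ < hi` only — so a large label space (`k ≥ 14`) is checked
in several kernel evaluations (theorems / files) and glued by `coverAutPerm_sound_of_chunks`. (definition) -/
def coverAutPermRangeOK (n : ℕ) (Ld L : List ℕ) (gens : List (List ℕ)) (words : List (List ℕ))
    (blocks : List BZBlock) (lo hi : ℕ) : Bool :=
  let cm := coverMask blocks
  let tabs := words.map fun w => rhoColsPerm n Ld L (wordPerm n gens w)
  (List.range' lo (hi - lo)).all fun lam =>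
    (lam == 0) || cm.testBit lam || tabs.any fun cols => cm.testBit (xorSel cols lam)

/-- Locating a label in a chunk: for cut points `c₀ :: cs` and `c₀ ≤ v < last`, some consecutive pair brackets `v`. -/
theorem exists_chunk_of_lt_getLast : ∀ (c : ℕ) (cs : List ℕ) (v : ℕ), c ≤ v → v < (c :: cs).getLast (by simp) →
    ∃ (i : ℕ) (hi : i + 1 < (c :: cs).length), (c :: cs)[i] ≤ v ∧ v < (c :: cs)[i + 1]
  | c, [], v, hc, hv => by simp at hv; omega
  | c, c' :: cs, v, hc, hv => by
    by_cases h : v < c'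
    · exact ⟨0, by simp, hc, h⟩
    · have hv' : v < (c' :: cs).getLast (by simp) := by
        rwa [List.getLast_cons (by simp)] at hv
      obtain ⟨i, hi, h1, h2⟩ := exists_chunk_of_lt_getLast c' cs v (not_lt.1 h) hv'
      exact ⟨i + 1, by simpa using hi, h1, h2⟩

/-- **Soundness of the range-sharded cover**: chunk verdicts along cut points `cuts = [0, c₁, …, 2^k]` (first `0`,
last `2^k`, each consecutive pair checked by `coverAutPermRangeOK`) give the conclusion of `coverAutPermOK_sound`. -/
theorem coverAutPerm_sound_of_chunks {Ld L : List ℕ} {gens words : List (List ℕ)} {blocks : List BZBlock}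
    (cuts : List ℕ) (hne : cuts ≠ []) (h0 : cuts.head hne = 0) (hlast : cuts.getLast hne = 2 ^ L.length)
    (hch : ∀ (i : ℕ) (hi : i + 1 < cuts.length),
      coverAutPermRangeOK n Ld L gens words blocks cuts[i] cuts[i + 1] = true)
    (hgens : ∀ g ∈ gens, permListOK n g = true) (hwords : ∀ w ∈ words, ∀ g ∈ w, g < gens.length)
    {P : (Fin L.length → ZMod 2) → Prop}
    (hP : ∀ w : ℕ, (coverMask blocks).testBit w = true → P (ofBits L.length w))
    {Ld' L' : Matrix (Fin L.length) (Fin n) (ZMod 2)}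
    (hLd : ∀ i, Ld' i = ofBits n (Ld.getD i 0)) (hL : ∀ j, L' j = ofBits n (L.getD j 0))
    (lam : Fin L.length → ZMod 2) (hlam : lam ≠ 0) :
    P lam ∨ ∃ w ∈ words, P ((Ld' * (L'.submatrix id (wordEquiv n gens w).symm)ᵀ) *ᵥ lam) := by
  obtain ⟨v, hvlt, rfl⟩ : ∃ v, v < 2 ^ L.length ∧ ofBits L.length v = lam :=
    ⟨toBits lam, toBits_lt lam, ofBits_toBits lam⟩
  have hv0 : v ≠ 0 := by
    rintro rfl
    exact hlam (ofBits_zero _)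
  obtain ⟨c, cs, rfl⟩ : ∃ c cs, cuts = c :: cs := by
    cases cuts with
    | nil => exact absurd rfl hne
    | cons c cs => exact ⟨c, cs, rfl⟩
  simp only [List.head_cons] at h0
  subst h0
  obtain ⟨i, hi, h1, h2⟩ := exists_chunk_of_lt_getLast 0 cs v (Nat.zero_le v) (by rw [hlast]; exact hvlt)
  have h := hch i hi
  simp only [coverAutPermRangeOK, List.all_eq_true, List.mem_range'_1, Bool.or_eq_true, beq_iff_eq,
    List.any_eq_true, List.mem_map] at h
  rcases h v ⟨h1, by omega⟩ with (h0' | hbit) | ⟨cols, ⟨w, hw, rfl⟩, hbit⟩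
  · exact absurd h0' hv0
  · exact Or.inl (hP v hbit)
  · refine Or.inr ⟨w, hw, ?_⟩
    rw [← ofBits_xorSel_rhoColsPerm hLd hL (wordEquiv n gens w) (wordEquiv_val hgens w (hwords w hw)) v]
    exact hP _ hbit

end Cover

/-! ## The `hcover` hypothesis and the assembled lower bounds -/

section Assembly

variable {n : ℕ}

/-- **`hcover` for explicit-permutation automorphisms, any engine.**  The tabulated cover over words gives the
`hcover` hypothesis of `bzAut_lower_sound` / `_sem` / `_mitm` for `α := {w // w ∈ words}`,
`ρ_w = LX · (LZ ∘ (wordEquiv n gens w)⁻¹)ᵀ` and the blocks' label spans (the generator check supplies the tables'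
validity, the word check the letters' range). -/
theorem bzAut_perm_hcover {Hsyn Hstab : List ℕ} {gens : List AutGen} (hgens : autGensOK n Hsyn Hstab gens = true)
    {words : List (List ℕ)} (hwords : autWordsOK gens.length words = true)
    {L Ld : List ℕ} {blocks : List BZBlock} (hcov : coverAutPermOK n Ld L (autPerms gens) words blocks = true) :
    ∀ lam : Fin L.length → ZMod 2, lam ≠ 0 →
      (∃ b : Fin blocks.length, lam ∈ Submodule.span (ZMod 2)
        (Set.range fun l : Fin (blocks[b]).W.length => ofBits L.length (blocks[b]).W[l])) ∨
      ∃ (a : {w : List ℕ // w ∈ words}) (b : Fin blocks.length),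
        (ldMat n L Ld * (Matrix.submatrix (fun i => logVec n L i : Matrix (Fin L.length) (Fin n) (ZMod 2)) id
            (wordEquiv n (autPerms gens) a.1).symm)ᵀ) *ᵥ lam ∈ Submodule.span (ZMod 2)
          (Set.range fun l : Fin (blocks[b]).W.length => ofBits L.length (blocks[b]).W[l]) := by
  intro lam hlam
  have hng : (autPerms gens).length = gens.length := List.length_map ..
  rcases coverAutPermOK_sound hcov (permListOK_of_autGensOK hgens)
      (fun w hw => by rw [hng]; exact lt_of_autWordsOK hwords hw)
      (P := fun μ => ∃ b : Fin blocks.length, μ ∈ Submodule.span (ZMod 2)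
        (Set.range fun l : Fin (blocks[b]).W.length => ofBits L.length (blocks[b]).W[l]))
      (fun v hv => testBit_coverMask_imp_exists_span _ _ hv)
      (Ld' := ldMat n L Ld) (L' := fun i => logVec n L i) (fun i => rfl)
      (fun j => by
        change ofBits n L[j] = ofBits n (L.getD j 0)
        rw [List.getD_eq_getElem?_getD, List.getElem?_eq_getElem j.2, Option.getD_some]
        rfl)
      lam hlam with hP | ⟨w, hw, hPw⟩
  · exact Or.inl hP
  · obtain ⟨b, hb⟩ := hPw
    exact Or.inr ⟨⟨w, hw⟩, b, hb⟩

/-- `hcover` from the WITNESSED cover check (same statement as `bzAut_perm_hcover`). -/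
theorem bzAut_perm_hcover_wit {Hsyn Hstab : List ℕ} {gens : List AutGen}
    (hgens : autGensOK n Hsyn Hstab gens = true)
    {words : List (List ℕ)} (hwords : autWordsOK gens.length words = true)
    {L Ld : List ℕ} {wit : List ℕ} {blocks : List BZBlock}
    (hcov : coverAutPermWitOK n Ld L (autPerms gens) words wit blocks = true) :
    ∀ lam : Fin L.length → ZMod 2, lam ≠ 0 →
      (∃ b : Fin blocks.length, lam ∈ Submodule.span (ZMod 2)
        (Set.range fun l : Fin (blocks[b]).W.length => ofBits L.length (blocks[b]).W[l])) ∨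
      ∃ (a : {w : List ℕ // w ∈ words}) (b : Fin blocks.length),
        (ldMat n L Ld * (Matrix.submatrix (fun i => logVec n L i : Matrix (Fin L.length) (Fin n) (ZMod 2)) id
            (wordEquiv n (autPerms gens) a.1).symm)ᵀ) *ᵥ lam ∈ Submodule.span (ZMod 2)
          (Set.range fun l : Fin (blocks[b]).W.length => ofBits L.length (blocks[b]).W[l]) := by
  intro lam hlam
  have hng : (autPerms gens).length = gens.length := List.length_map ..
  rcases coverAutPermWitOK_sound hcov (permListOK_of_autGensOK hgens)
      (fun w hw => by rw [hng]; exact lt_of_autWordsOK hwords hw)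
      (P := fun μ => ∃ b : Fin blocks.length, μ ∈ Submodule.span (ZMod 2)
        (Set.range fun l : Fin (blocks[b]).W.length => ofBits L.length (blocks[b]).W[l]))
      (fun v hv => testBit_coverMask_imp_exists_span _ _ hv)
      (Ld' := ldMat n L Ld) (L' := fun i => logVec n L i) (fun i => rfl)
      (fun j => by
        change ofBits n L[j] = ofBits n (L.getD j 0)
        rw [List.getD_eq_getElem?_getD, List.getElem?_eq_getElem j.2, Option.getD_some]
        rfl)
      lam hlam with hP | ⟨w, hw, hPw⟩
  · exact Or.inl hP
  · obtain ⟨b, hb⟩ := hPw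
    exact Or.inr ⟨⟨w, hw⟩, b, hb⟩

/-- `hcover` from RANGE-SHARDED cover verdicts along cut points `[0, c₁, …, 2^k]` (same statement as
`bzAut_perm_hcover`; prove `hch` from per-chunk theorems by `intro i hi; interval_cases i <;> assumption`-style case
splits). -/
theorem bzAut_perm_hcover_chunks {Hsyn Hstab : List ℕ} {gens : List AutGen}
    (hgens : autGensOK n Hsyn Hstab gens = true)
    {words : List (List ℕ)} (hwords : autWordsOK gens.length words = true)
    {L Ld : List ℕ} {blocks : List BZBlock}
    (cuts : List ℕ) (hne : cuts ≠ []) (h0 : cuts.head hne = 0) (hlast : cuts.getLast hne = 2 ^ L.length)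
    (hch : ∀ (i : ℕ) (hi : i + 1 < cuts.length),
      coverAutPermRangeOK n Ld L (autPerms gens) words blocks cuts[i] cuts[i + 1] = true) :
    ∀ lam : Fin L.length → ZMod 2, lam ≠ 0 →
      (∃ b : Fin blocks.length, lam ∈ Submodule.span (ZMod 2)
        (Set.range fun l : Fin (blocks[b]).W.length => ofBits L.length (blocks[b]).W[l])) ∨
      ∃ (a : {w : List ℕ // w ∈ words}) (b : Fin blocks.length),
        (ldMat n L Ld * (Matrix.submatrix (fun i => logVec n L i : Matrix (Fin L.length) (Fin n) (ZMod 2)) id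
            (wordEquiv n (autPerms gens) a.1).symm)ᵀ) *ᵥ lam ∈ Submodule.span (ZMod 2)
          (Set.range fun l : Fin (blocks[b]).W.length => ofBits L.length (blocks[b]).W[l]) := by
  intro lam hlam
  have hng : (autPerms gens).length = gens.length := List.length_map ..
  rcases coverAutPerm_sound_of_chunks cuts hne h0 hlast hch (permListOK_of_autGensOK hgens)
      (fun w hw => by rw [hng]; exact lt_of_autWordsOK hwords hw)
      (P := fun μ => ∃ b : Fin blocks.length, μ ∈ Submodule.span (ZMod 2)
        (Set.range fun l : Fin (blocks[b]).W.length => ofBits L.length (blocks[b]).W[l]))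
      (fun v hv => testBit_coverMask_imp_exists_span _ _ hv)
      (Ld' := ldMat n L Ld) (L' := fun i => logVec n L i) (fun i => rfl)
      (fun j => by
        change ofBits n L[j] = ofBits n (L.getD j 0)
        rw [List.getD_eq_getElem?_getD, List.getElem?_eq_getElem j.2, Option.getD_some]
        rfl)
      lam hlam with hP | ⟨w, hw, hPw⟩
  · exact Or.inl hP
  · obtain ⟨b, hb⟩ := hPw
    exact Or.inr ⟨⟨w, hw⟩, b, hb⟩

/-- **The `bz_aut` lower bound with explicit-permutation automorphisms, BZ engine, certificate level, ANY CSS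
certificate.**  Check words `Hsyn` (syndromes) and `Hstab` (stabilizers) on `n` qubits, commuting; the checker's
structural verdicts (`foundOK`, `bzCoreOK`, `bzLenOK`), the representative blocks' enumeration verdicts (`bzBlockOK`),
the generator / word checks (`autGensOK`, `autWordsOK`) and the tabulated cover over words (`coverAutPermOK`) — all
`decide` — give: every vector with zero syndrome outside the stabilizer row space has weight `> wmax`.  This is
type-10's `bzAut_lower_sound` applied to `bzAut_perm_hφ` and `bzAut_perm_hcover`; no typed code family is involved. -/
theorem bzAut_perm_lower {Hsyn Hstab : List ℕ} {rcY rcS : RankCert} {L Ld : List ℕ} {s : BZSide} {wmax : ℕ}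
    {found : List (ℕ × List ℕ)}
    (hcomm : rowMatrix n Hsyn * (rowMatrix n Hstab)ᵀ = 0) (hfound : foundOK Hstab found = true)
    (hcore : bzCoreOK n Hsyn Hstab rcY rcS L Ld s.evenWitness = true) (hlen : bzLenOK Hstab rcS L s = true)
    (hb : ∀ b : ℕ, b < s.blocks.length → bzBlockOK n Hstab rcS L wmax (found.map Prod.fst) s b = true)
    {gens : List AutGen} (hgens : autGensOK n Hsyn Hstab gens = true)
    {words : List (List ℕ)} (hwords : autWordsOK gens.length words = true)
    (hcov : coverAutPermOK n Ld L (autPerms gens) words s.blocks = true)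
    (w : Fin n → ZMod 2) (hw : rowMatrix n Hsyn *ᵥ w = 0) (hw' : w ∉ rowSpace (rowMatrix n Hstab)) :
    wmax < hammingNorm w :=
  bzAut_lower_sound (s := s) hcomm hfound hcore hlen hb _ _ (bzAut_perm_hφ hcomm hcore hgens hwords)
    (bzAut_perm_hcover hgens hwords hcov) w hw hw'

/-- **The same, LANE-AGNOSTIC** (per-block hypothesis in semantic form, as type-10's `bzAut_lower_sound_sem`): any
certified per-block method (BZ enumeration, meet-in-the-middle, plane sweep) plugs in through `hblock`. -/
theorem bzAut_perm_lower_sem {Hsyn Hstab : List ℕ} {rcY rcS : RankCert} {L Ld : List ℕ} {s : BZSide} {wmax : ℕ}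
    (hcomm : rowMatrix n Hsyn * (rowMatrix n Hstab)ᵀ = 0)
    (hcore : bzCoreOK n Hsyn Hstab rcY rcS L Ld s.evenWitness = true)
    (hblock : ∀ (b : Fin s.blocks.length) (z : Fin n → ZMod 2), rowMatrix n Hsyn *ᵥ z = 0 →
      z ∉ rowSpace (rowMatrix n Hstab) → ldMat n L Ld *ᵥ z ∈ Submodule.span (ZMod 2)
        (Set.range fun l : Fin (s.blocks[b]).W.length => ofBits L.length (s.blocks[b]).W[l]) →
      wEff wmax s.evenWitness < hammingNorm z)
    {gens : List AutGen} (hgens : autGensOK n Hsyn Hstab gens = true)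
    {words : List (List ℕ)} (hwords : autWordsOK gens.length words = true)
    (hcov : coverAutPermOK n Ld L (autPerms gens) words s.blocks = true)
    (w : Fin n → ZMod 2) (hw : rowMatrix n Hsyn *ᵥ w = 0) (hw' : w ∉ rowSpace (rowMatrix n Hstab)) :
    wmax < hammingNorm w :=
  bzAut_lower_sound_sem (s := s) hcomm hcore hblock _ _ (bzAut_perm_hφ hcomm hcore hgens hwords)
    (bzAut_perm_hcover hgens hwords hcov) w hw hw'

end Assembly

/-! ## Smoke tests (kernel `decide` evaluates the tabulated cover) -/

/-- One logical (`k = 1`) on `n = 2` qubits, `L = [01₂]`, `Ld = [01₂]`; the swap `[1,0]` moves it off `Ld`: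
with no blocks nothing is covered; one block spanning the label covers directly. -/
example : coverAutPermOK 2 [1] [1] [[1, 0]] [[0]] [] = false ∧
    coverAutPermOK 2 [1] [1] [[1, 0]] [[0]] [⟨[1], []⟩] = true := by decide

/-- `k = 2` on `n = 2`: `L = Ld = [01₂, 10₂]`; blocks covering the labels `01₂` and `11₂` do NOT cover `10₂`
by themselves, but do after the swap `[1,0]` (word `[0]`), which exchanges the two logicals (`10₂ ↦ 01₂`; it fixes
`11₂`, which therefore needs its own block); the witnessed form agrees (`wit[2] = 0`). -/
example : coverAutPermOK 2 [1, 2] [1, 2] [[1, 0]] [] [⟨[1], []⟩, ⟨[3], []⟩] = false ∧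
    coverAutPermOK 2 [1, 2] [1, 2] [[1, 0]] [[0]] [⟨[1], []⟩, ⟨[3], []⟩] = true ∧
    coverAutPermOK 2 [1, 2] [1, 2] [[1, 0]] [[0]] [⟨[1], []⟩] = false ∧
    coverAutPermWitOK 2 [1, 2] [1, 2] [[1, 0]] [[0]] [0, 0, 0, 0] [⟨[1], []⟩, ⟨[3], []⟩] = true := by decide

/-- Range-sharded replay of the same cover in two chunks `[0,2)` and `[2,4)`. -/
example : coverAutPermRangeOK 2 [1, 2] [1, 2] [[1, 0]] [[0]] [⟨[1], []⟩, ⟨[3], []⟩] 0 2 = true ∧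
    coverAutPermRangeOK 2 [1, 2] [1, 2] [[1, 0]] [[0]] [⟨[1], []⟩, ⟨[3], []⟩] 2 4 = true ∧
    coverAutPermRangeOK 2 [1, 2] [1, 2] [[1, 0]] [] [⟨[1], []⟩, ⟨[3], []⟩] 2 4 = false := by decide

end Summit.Ventures.QEC.Census
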